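import Summits.QuantumFields.YangMills.Theorems.UnitScaleTiltProp7CombAccFrameStep
import Literature.MathematicalPhysics.QuantumFieldTheory.Balaban1983to89.B11Eq98V0LettersFlat
import HarnessLib

/-!
# Route `UnitScaleTilt`, crux K1 «MinimiserStabilityRegPr» (stmt-QuantumFields-19200), route-R E′ (A′)-on-Σ, P-A2-COMB (β), item «F3″-COMB» (★★OWNER RULING №19), file F2 —
# THE ONE-STEP COMB ACCUMULATED-FRAME INEQUALITY IN `ℓ²` OVER ONE PERIOD CELL (generic level `l`, every input displayed):
# `Φᶜ_{l+1} ≤ 3((Lᵈ)⁻¹ + 144t*²)·Φᶜ_l + 3(1 + 6t*)²·C_R²·Σ_z B(z)`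

Cell `ym3-torus`, extra width seat `ym-routeR-w6` (gen 8); LOCATE `LOCATE-F3COMB-routeRw6g8.md` (19200 evidence #54) §1 (c2); ★★OWNER RULING №19.  THEOREMS ONLY (0 `def`, 0 `sorry`);
`--supports stmt-QuantumFields-19200 --as helper`, count-neutral.  YM₃ on T³ is a ladder rung (R3), not the Clay problem; nothing here claims the stub, the crux, (β), `hPA2`, `hcoS`, d = 4 or the gap.

THE POINT.  File F1 (✓ `Prop7CombAccFrameStep.norm_vcov_succ_sub_one_le_of_bicontractive`) bounds print's comb accumulated frame ((97), lit `B7Eq92Concrete.vcov`) one level up, POINTWISE on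
`ℤᵈ`: `‖v_{l+1}(z) − 1‖ ≤ (Lᵈ)⁻¹Σ_r (‖R_r(z) − 1‖ + ‖v_l(L•z + r) − 1‖) + 6t²`, `R_r(z)` the single-bar tree ratio of print's comb tower along `Γ_r` from the corner `L•z`.  Here the frames are
INDEXED BY ONE PERIOD CELL: the level-`l` sites `x : Site P l` of the torus carry the canonical labels `x̂ = (x μ).val ∈ [0, N_l)ᵈ ⊂ ℤᵈ` (lit `Node00.coverAt_valLift`'s section), and the comb
mass is `Φᶜ_l := Σ_{x : Site P l} ‖v_l(x̂) − 1‖²`.  The cornered box of `z : Site P (l+1)` is EXACTLY the label set of its block: `L•ẑ + boxVec r = (blockSite z r)^` (lit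
`Site.val_blockSite`, §1) — so no periodicity and no `ℤᵈ ↔ T` dictionary is needed: the blocks tile the cell (✓ `Prop7BlockMeanContraction.sum_sum_block_eq`), the block mean contracts
site masses by `(Lᵈ)⁻¹` (Cauchy–Schwarz), and the quadratic `6t²` is summed through the LOCAL sup letter `t_z ≤ min(t*, C_R√B(z) + 2√V(z))` exactly as in ✓px22 `Prop7FrameMassStep`.
Output = the `hΦ` hypothesis of ✓ `Prop7TwistedLevelMassInduction.frameMass_induction` with `q = 3((Lᵈ)⁻¹ + 144t*²)`, `C·M_l = 3(1+6t*)²C_R²·Σ_z B(z)`; file F3 supplies `B` from the single-bar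
tree-ratio mass of print's comb tower (the displayed route-internal row `hMcomb`, OPEN, XL — NOT N06, NOT a print row) and the sup∕unitarity letters from lit `B8Prop7AdmittedFamily`.

WHAT IS PROVED (ns `…Theorems.Prop7CombAccFrameMassStep`; generic `P : Params`, level `l` with `l + 1 ≤ m + K`, ANY fields `U₀ U₁ : ℤᵈ → 𝔸ˣ` over a complete normed ℂ-algebra).
* §1 `valLift_blockSite` — `(blockSite z r)^ = L•ẑ + boxVec L r`; `sum_blockLift_eq` — `Σ_z Σ_r f((blockSite z r)^) = Σ_x f(x̂)`; `sum_sq_blockMeanLift_le` — `Σ_z ((Lᵈ)⁻¹Σ_r f((blockSite z r)^))² ≤ (Lᵈ)⁻¹Σ_x f(x̂)²`.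
* §2 `le_sqrt_sum_sq`, ★★★ `combFrameMass_step_le` — the title.
HONEST SCOPE.  Real bookkeeping over F1; every analytic input (bi-contractivity, frame sup `δ₂`, tree-ratio rows `hR`∕`hρB`) is displayed; no summit statement is advanced.

References: T. Bałaban, CMP 98 (1985) 17–51 [Balaban1985Averaging] ((82) p.30, (85) p.31, (97) p.32, Prop. 3 (122)–(126) p.36); CMP 109 (1987) 249–301 [Balaban1987RG1] ((0.3)–(0.4) pp.252–253).
-/

set_option autoImplicit false

noncomputable section

open scoped BigOperators

namespace Summit.QuantumFields.YangMills.Theorems.Prop7CombAccFrameMassStep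

open Finset NormedSpace
open Literature.MathematicalPhysics.QuantumFieldTheory.Balaban1983to89
open T4Continuum BlockAveraging
open B7Prop1Explicit (hol treeWord boxVec)
open B7Prop2Explicit (avgIter)
open B7Eq92Concrete (Rc Rc_apply tHol tildIter dbavgCovIter vcov)
open Summit.QuantumFields.YangMills.Theorems.LinearLiftGauge (sum_blockSite_eq)
open Summit.QuantumFields.YangMills.Theorems.Prop7BlockMeanContraction (sum_sum_block_eq)
open Summit.QuantumFields.YangMills.Theorems.Prop7AccumulatedFrameStep (norm_inv_mul_sub_one_le)
open Summit.QuantumFields.YangMills.Theorems.Prop7FrameMassStep (norm_conj_sub_one_le)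
open Summit.QuantumFields.YangMills.Theorems.Prop7CombAccFrameStep (tHol_dbavgCovIter_eq_frame_inv_mul norm_vcov_succ_sub_one_le_of_bicontractive)
open B11Eq98V0LettersFlat (norm_inv_sub_one_le)

variable {P : Params} {l : ℕ}

/-! ## §1 The cornered box of a coarse site is the label set of its block; the block mean contracts site masses -/

/-- **THE CORNERED BOX IS THE BLOCK**: the canonical label of the fine site of the block over `z` at offset `r` is `L•ẑ + r` (lit `Site.val_blockSite`: `nL + r`, no wrap-around in the
standing range). [cite: Balaban1987RG1, (0.3) p.252] -/
theorem valLift_blockSite (hl : l + 1 ≤ P.m + P.K) (z : Site P (l + 1)) (r : Fin P.d → Fin P.L) :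
    (fun μ => (((Site.blockSite z r) μ).val : ℤ)) = (P.L : ℤ) • (fun μ => ((z μ).val : ℤ)) + boxVec P.L r := by
  funext μ
  simp only [Pi.add_apply, Pi.smul_apply, smul_eq_mul, boxVec, Site.val_blockSite hl]
  push_cast
  ring

/-- the blocks tile the cell: `Σ_z Σ_r f((blockSite z r)^) = Σ_x f(x̂)`. [cite: Balaban1987RG1, (0.3) p.252] -/
theorem sum_blockLift_eq (hl : l + 1 ≤ P.m + P.K) (f : (Fin P.d → ℤ) → ℝ) :
    ∑ z : Site P (l + 1), ∑ r : Fin P.d → Fin P.L, f (fun μ => (((Site.blockSite z r) μ).val : ℤ)) = ∑ x : Site P l, f (fun μ => ((x μ).val : ℤ)) := by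
  have e : ∀ z : Site P (l + 1), ∑ r : Fin P.d → Fin P.L, f (fun μ => (((Site.blockSite z r) μ).val : ℤ)) = ∑ x ∈ block z, f (fun μ => ((x μ).val : ℤ)) :=
    fun z => sum_blockSite_eq hl z (fun x => f (fun μ => ((x μ).val : ℤ)))
  rw [Finset.sum_congr rfl (fun z _ => e z), sum_sum_block_eq]

/-- **THE BLOCK MEAN CONTRACTS SITE MASSES BY `(Lᵈ)⁻¹`** (Cauchy–Schwarz on each block, `Lᵈ` sites, and the tiling). [cite: Balaban1987RG1, (0.3)-(0.4) pp.252-253; Balaban1985Averaging, (97) p.32] -/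
theorem sum_sq_blockMeanLift_le (hl : l + 1 ≤ P.m + P.K) (f : (Fin P.d → ℤ) → ℝ) :
    ∑ z : Site P (l + 1), (((P.L : ℝ) ^ P.d)⁻¹ * ∑ r : Fin P.d → Fin P.L, f (fun μ => (((Site.blockSite z r) μ).val : ℤ))) ^ 2
      ≤ ((P.L : ℝ) ^ P.d)⁻¹ * ∑ x : Site P l, f (fun μ => ((x μ).val : ℤ)) ^ 2 := by
  have hL : (0 : ℝ) < (P.L : ℝ) ^ P.d := pow_pos (Nat.cast_pos.2 P.L_pos) _
  have hcard : ((Finset.univ : Finset (Fin P.d → Fin P.L)).card : ℝ) = (P.L : ℝ) ^ P.d := by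
    simp only [Finset.card_univ, Fintype.card_fun, Fintype.card_fin]; push_cast; ring
  have hblock : ∀ z : Site P (l + 1), (((P.L : ℝ) ^ P.d)⁻¹ * ∑ r : Fin P.d → Fin P.L, f (fun μ => (((Site.blockSite z r) μ).val : ℤ))) ^ 2
      ≤ ((P.L : ℝ) ^ P.d)⁻¹ * ∑ r : Fin P.d → Fin P.L, f (fun μ => (((Site.blockSite z r) μ).val : ℤ)) ^ 2 := by
    intro z
    have hcs := sq_sum_le_card_mul_sum_sq (s := (Finset.univ : Finset (Fin P.d → Fin P.L))) (f := fun r => f (fun μ => (((Site.blockSite z r) μ).val : ℤ)))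
    rw [hcard] at hcs
    rw [mul_pow, sq]
    have e : ((P.L : ℝ) ^ P.d)⁻¹ * ((P.L : ℝ) ^ P.d)⁻¹ * (∑ r : Fin P.d → Fin P.L, f (fun μ => (((Site.blockSite z r) μ).val : ℤ))) ^ 2
        ≤ ((P.L : ℝ) ^ P.d)⁻¹ * ((P.L : ℝ) ^ P.d)⁻¹ * ((P.L : ℝ) ^ P.d * ∑ r : Fin P.d → Fin P.L, f (fun μ => (((Site.blockSite z r) μ).val : ℤ)) ^ 2) :=
      mul_le_mul_of_nonneg_left hcs (by positivity)
    refine e.trans (le_of_eq ?_)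
    field_simp
  refine (Finset.sum_le_sum fun z _ => hblock z).trans (le_of_eq ?_)
  rw [← Finset.mul_sum, sum_blockLift_eq hl (fun x => f x ^ 2)]

/-! ## §2 ★★★ The `ℓ²` step -/

section Step

variable {𝔸 : Type*} [NormedRing 𝔸] [NormedAlgebra ℂ 𝔸] [CompleteSpace 𝔸]

/-- a single term is at most the square root of the sum of squares. [folklore] -/
theorem le_sqrt_sum_sq {ι : Type*} [Fintype ι] (g : ι → ℝ) (hg : ∀ i, 0 ≤ g i) (i : ι) : g i ≤ Real.sqrt (∑ j, g j ^ 2) := by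
  rw [← Real.sqrt_sq (hg i)]
  exact Real.sqrt_le_sqrt (Finset.single_le_sum (f := fun j => g j ^ 2) (fun j _ => sq_nonneg _) (Finset.mem_univ i))

/-- ★★★ **THE ONE-STEP COMB ACCUMULATED-FRAME INEQUALITY IN `ℓ²` OVER ONE PERIOD CELL.**  Level `l` (`l + 1 ≤ m + K`), fields `U₀ U₁ : ℤᵈ → 𝔸ˣ`, comb accumulated frames `v_l = vcov L U₀ U₁ l`
((97)) read on the canonical labels `x̂` of the torus sites, `Φᶜ_l := Σ_{x : Site P l} ‖v_l(x̂) − 1‖²`.  DISPLAYED per level: the background tree transports `Ū₀ˡ(Γ_r)` from the corners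
are bi-contractive; the frames are bi-contractive on the cell and within `δ₂` of `1`; the single-bar tree ratios `R_r(z) = (R_{0,L•ẑ}Ũ₁ˡ)(Γ_r)` of print's comb tower obey `‖R_r(z) − 1‖ ≤ C_R·√B(z)`
with `C_R√B(z) ≤ ρ`, and `t* := ρ + 3δ₂ ≤ ¼`.  THEN
`Φᶜ_{l+1} ≤ 3((Lᵈ)⁻¹ + 144t*²)·Φᶜ_l + 3(1 + 6t*)²·C_R²·Σ_z B(z)` — the `hΦ` step of ✓ `frameMass_induction` for print's comb frames.
[cite: Balaban1985Averaging, (82) p.30, (85) p.31, (97) p.32, Prop. 3 (122)-(126) p.36; Balaban1987RG1, (0.3)-(0.4) pp.252-253] -/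
theorem combFrameMass_step_le (hl : l + 1 ≤ P.m + P.K) (U₀ U₁ : (Fin P.d → ℤ) → Fin P.d → 𝔸ˣ) {δ₂ ρ CR : ℝ} (B : Site P (l + 1) → ℝ)
    (hCR : 0 ≤ CR) (hB0 : ∀ z, 0 ≤ B z) (hδ₂ : 0 ≤ δ₂) (hρ : 0 ≤ ρ)
    (hhol : ∀ (z : Site P (l + 1)) (r : Fin P.d → Fin P.L),
      ‖((hol (avgIter P.L U₀ l) ((P.L : ℤ) • (fun μ => ((z μ).val : ℤ))) (treeWord (boxVec P.L r)) : 𝔸ˣ) : 𝔸)‖ ≤ 1 ∧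
        ‖(((hol (avgIter P.L U₀ l) ((P.L : ℤ) • (fun μ => ((z μ).val : ℤ))) (treeWord (boxVec P.L r)))⁻¹ : 𝔸ˣ) : 𝔸)‖ ≤ 1)
    (hv1 : ∀ x : Site P l, ‖(vcov P.L U₀ U₁ l (fun μ => ((x μ).val : ℤ)) : 𝔸)‖ ≤ 1)
    (hv1' : ∀ x : Site P l, ‖(((vcov P.L U₀ U₁ l (fun μ => ((x μ).val : ℤ)))⁻¹ : 𝔸ˣ) : 𝔸)‖ ≤ 1)
    (hv2 : ∀ x : Site P l, ‖(vcov P.L U₀ U₁ l (fun μ => ((x μ).val : ℤ)) : 𝔸) - 1‖ ≤ δ₂)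
    (hR : ∀ (z : Site P (l + 1)) (r : Fin P.d → Fin P.L),
      ‖((tHol (avgIter P.L U₀ l) (tildIter P.L U₀ U₁ l) ((P.L : ℤ) • (fun μ => ((z μ).val : ℤ))) (treeWord (boxVec P.L r)) : 𝔸ˣ) : 𝔸) - 1‖ ≤ CR * Real.sqrt (B z))
    (hρB : ∀ z, CR * Real.sqrt (B z) ≤ ρ) (ht : ρ + 3 * δ₂ ≤ 1 / 4) :
    ∑ z : Site P (l + 1), ‖(vcov P.L U₀ U₁ (l + 1) (fun μ => ((z μ).val : ℤ)) : 𝔸) - 1‖ ^ 2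
      ≤ 3 * (((P.L : ℝ) ^ P.d)⁻¹ + 144 * (ρ + 3 * δ₂) ^ 2) * ∑ x : Site P l, ‖(vcov P.L U₀ U₁ l (fun μ => ((x μ).val : ℤ)) : 𝔸) - 1‖ ^ 2
        + 3 * (1 + 6 * (ρ + 3 * δ₂)) ^ 2 * CR ^ 2 * ∑ z : Site P (l + 1), B z := by
  have hLpos : 0 < P.L := P.L_pos
  have hLd : (0 : ℝ) < (P.L : ℝ) ^ P.d := pow_pos (Nat.cast_pos.2 hLpos) _
  have ht0 : 0 ≤ ρ + 3 * δ₂ := by positivity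
  have hcard : (Fintype.card (Fin P.d → Fin P.L) : ℝ) = (P.L : ℝ) ^ P.d := by
    rw [Fintype.card_fun, Fintype.card_fin, Fintype.card_fin]; push_cast; ring
  -- letters: the frame deviation on the labels, the block mass of the old frames
  set f : (Fin P.d → ℤ) → ℝ := fun x => ‖(vcov P.L U₀ U₁ l x : 𝔸) - 1‖ with hf
  have hf0 : ∀ x, 0 ≤ f x := fun x => norm_nonneg _
  -- the pointwise bound at every coarse site
  have hpt : ∀ z : Site P (l + 1), ‖(vcov P.L U₀ U₁ (l + 1) (fun μ => ((z μ).val : ℤ)) : 𝔸) - 1‖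
      ≤ (1 + 6 * (ρ + 3 * δ₂)) * (CR * Real.sqrt (B z))
        + ((P.L : ℝ) ^ P.d)⁻¹ * ∑ r : Fin P.d → Fin P.L, f (fun μ => (((Site.blockSite z r) μ).val : ℤ))
        + 12 * (ρ + 3 * δ₂) * Real.sqrt (∑ r : Fin P.d → Fin P.L, f (fun μ => (((Site.blockSite z r) μ).val : ℤ)) ^ 2) := by
    intro z
    set zh : Fin P.d → ℤ := fun μ => ((z μ).val : ℤ) with hzh
    -- the box points are the block sites' labels
    have hbox : ∀ r : Fin P.d → Fin P.L, (P.L : ℤ) • zh + boxVec P.L r = fun μ => (((Site.blockSite z r) μ).val : ℤ) :=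
      fun r => (valLift_blockSite hl z r).symm
    -- the local sup letter `t_z ≤ min (t*, C_R√B + 2√V)`
    set V : ℝ := ∑ r : Fin P.d → Fin P.L, f (fun μ => (((Site.blockSite z r) μ).val : ℤ)) ^ 2 with hV
    have hVr : ∀ r : Fin P.d → Fin P.L, f ((P.L : ℤ) • zh + boxVec P.L r) ≤ Real.sqrt V := by
      intro r
      rw [hbox r]
      exact le_sqrt_sum_sq (fun r' => f (fun μ => (((Site.blockSite z r') μ).val : ℤ))) (fun _ => hf0 _) r
    -- the corner `L•ẑ` is the block site at offset `0`
    have hcorner : (P.L : ℤ) • zh = fun μ => (((Site.blockSite z (fun _ => ⟨0, hLpos⟩)) μ).val : ℤ) := by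
      rw [← hbox]; funext μ; simp [boxVec]
    have hv1c : ‖(vcov P.L U₀ U₁ l ((P.L : ℤ) • zh) : 𝔸)‖ ≤ 1 := by rw [hcorner]; exact hv1 _
    have hv1c' : ‖(((vcov P.L U₀ U₁ l ((P.L : ℤ) • zh))⁻¹ : 𝔸ˣ) : 𝔸)‖ ≤ 1 := by rw [hcorner]; exact hv1' _
    have hv1r : ∀ r : Fin P.d → Fin P.L, ‖(vcov P.L U₀ U₁ l ((P.L : ℤ) • zh + boxVec P.L r) : 𝔸)‖ ≤ 1 := fun r => by rw [hbox r]; exact hv1 _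
    have hv2r : ∀ r : Fin P.d → Fin P.L, ‖(vcov P.L U₀ U₁ l ((P.L : ℤ) • zh + boxVec P.L r) : 𝔸) - 1‖ ≤ δ₂ := fun r => by rw [hbox r]; exact hv2 _
    have hv2c : ‖(((vcov P.L U₀ U₁ l ((P.L : ℤ) • zh))⁻¹ : 𝔸ˣ) : 𝔸) - 1‖ ≤ f ((P.L : ℤ) • zh + boxVec P.L (fun _ => ⟨0, hLpos⟩)) := by
      have h0 : (P.L : ℤ) • zh + boxVec P.L (fun _ => ⟨0, hLpos⟩) = (P.L : ℤ) • zh := by funext μ; simp [boxVec]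
      rw [h0]
      exact norm_inv_sub_one_le _ hv1c'
    -- every twisted tree transport of the double-bar tower within `t_z` of `1`
    set tloc : ℝ := CR * Real.sqrt (B z) + 2 * Real.sqrt V with htloc
    set tz : ℝ := min (ρ + 3 * δ₂) tloc with htz
    have htz_le : ∀ r : Fin P.d → Fin P.L,
        ‖((tHol (avgIter P.L U₀ l) (dbavgCovIter P.L U₀ U₁ l) ((P.L : ℤ) • zh) (treeWord (boxVec P.L r)) : 𝔸ˣ) : 𝔸) - 1‖ ≤ tz := by
      intro r
      rw [tHol_dbavgCovIter_eq_frame_inv_mul, B7Prop1Explicit.disp_treeWord, Units.val_mul, Units.val_mul]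
      -- `‖v⁻¹(R a) − 1‖ ≤ ‖R − 1‖ + ‖a − 1‖ + ‖v⁻¹ − 1‖`
      have ha1 : ‖((Rc (hol (avgIter P.L U₀ l) ((P.L : ℤ) • zh) (treeWord (boxVec P.L r))) (vcov P.L U₀ U₁ l ((P.L : ℤ) • zh + boxVec P.L r)) : 𝔸ˣ) : 𝔸) - 1‖
          ≤ ‖(vcov P.L U₀ U₁ l ((P.L : ℤ) • zh + boxVec P.L r) : 𝔸) - 1‖ := by
        rw [Rc_apply]; exact norm_conj_sub_one_le _ _ (hhol z r).1 (hhol z r).2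
      have ha0 : ‖((Rc (hol (avgIter P.L U₀ l) ((P.L : ℤ) • zh) (treeWord (boxVec P.L r))) (vcov P.L U₀ U₁ l ((P.L : ℤ) • zh + boxVec P.L r)) : 𝔸ˣ) : 𝔸)‖ ≤ 1 := by
        rw [Rc_apply]; exact Prop7FrameMassStep.norm_conj_le_one _ _ (hhol z r).1 (hhol z r).2 (hv1r r)
      have hRa : ‖((tHol (avgIter P.L U₀ l) (tildIter P.L U₀ U₁ l) ((P.L : ℤ) • zh) (treeWord (boxVec P.L r)) : 𝔸ˣ) : 𝔸)
            * ((Rc (hol (avgIter P.L U₀ l) ((P.L : ℤ) • zh) (treeWord (boxVec P.L r))) (vcov P.L U₀ U₁ l ((P.L : ℤ) • zh + boxVec P.L r)) : 𝔸ˣ) : 𝔸) - 1‖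
          ≤ ‖((tHol (avgIter P.L U₀ l) (tildIter P.L U₀ U₁ l) ((P.L : ℤ) • zh) (treeWord (boxVec P.L r)) : 𝔸ˣ) : 𝔸) - 1‖
            + ‖((Rc (hol (avgIter P.L U₀ l) ((P.L : ℤ) • zh) (treeWord (boxVec P.L r))) (vcov P.L U₀ U₁ l ((P.L : ℤ) • zh + boxVec P.L r)) : 𝔸ˣ) : 𝔸) - 1‖ := by
        set Rr := ((tHol (avgIter P.L U₀ l) (tildIter P.L U₀ U₁ l) ((P.L : ℤ) • zh) (treeWord (boxVec P.L r)) : 𝔸ˣ) : 𝔸)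
        set ar := ((Rc (hol (avgIter P.L U₀ l) ((P.L : ℤ) • zh) (treeWord (boxVec P.L r))) (vcov P.L U₀ U₁ l ((P.L : ℤ) • zh + boxVec P.L r)) : 𝔸ˣ) : 𝔸)
        have e : Rr * ar - 1 = (Rr - 1) * ar + (ar - 1) := by noncomm_ring
        rw [e]
        refine (norm_add_le _ _).trans (add_le_add ?_ le_rfl)
        exact (norm_mul_le _ _).trans (mul_le_of_le_one_right (norm_nonneg _) ha0)
      have h3 := norm_inv_mul_sub_one_le (vcov P.L U₀ U₁ l ((P.L : ℤ) • zh)) hv1c'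
        (((tHol (avgIter P.L U₀ l) (tildIter P.L U₀ U₁ l) ((P.L : ℤ) • zh) (treeWord (boxVec P.L r)) : 𝔸ˣ) : 𝔸)
          * ((Rc (hol (avgIter P.L U₀ l) ((P.L : ℤ) • zh) (treeWord (boxVec P.L r))) (vcov P.L U₀ U₁ l ((P.L : ℤ) • zh + boxVec P.L r)) : 𝔸ˣ) : 𝔸))
      refine le_min ?_ ?_
      · -- the uniform sup `t* = ρ + 3δ₂`
        calc _ ≤ (CR * Real.sqrt (B z) + δ₂) + δ₂ := h3.trans (add_le_add (hRa.trans (add_le_add (hR z r) (ha1.trans (hv2r r))))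
              (hv2c.trans (hv2r _)))
          _ ≤ ρ + 3 * δ₂ := by linarith [hρB z]
      · -- the local letter `C_R√B + 2√V`
        calc _ ≤ (CR * Real.sqrt (B z) + Real.sqrt V) + Real.sqrt V := h3.trans (add_le_add (hRa.trans (add_le_add (hR z r) (ha1.trans (hVr r))))
              (hv2c.trans (hVr _)))
          _ = tloc := by rw [htloc]; ring
    have htz4 : tz ≤ 1 / 4 := (min_le_left _ _).trans ht
    have htz0 : 0 ≤ tz := le_min ht0 (by positivity)
    -- F1 at the local sup letter
    have hF1 := norm_vcov_succ_sub_one_le_of_bicontractive hLpos U₀ U₁ l zh (hhol z) hv1c hv1r htz_le htz4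
    -- the tree-ratio mean and the quadratic term
    have hmeanR : (Fintype.card (Fin P.d → Fin P.L) : ℝ)⁻¹ * ∑ r : Fin P.d → Fin P.L,
        (‖((tHol (avgIter P.L U₀ l) (tildIter P.L U₀ U₁ l) ((P.L : ℤ) • zh) (treeWord (boxVec P.L r)) : 𝔸ˣ) : 𝔸) - 1‖
          + ‖(vcov P.L U₀ U₁ l ((P.L : ℤ) • zh + boxVec P.L r) : 𝔸) - 1‖)
        ≤ CR * Real.sqrt (B z) + ((P.L : ℝ) ^ P.d)⁻¹ * ∑ r : Fin P.d → Fin P.L, f (fun μ => (((Site.blockSite z r) μ).val : ℤ)) := by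
      rw [hcard, Finset.sum_add_distrib, mul_add]
      refine add_le_add ?_ (le_of_eq ?_)
      · calc ((P.L : ℝ) ^ P.d)⁻¹ * ∑ r : Fin P.d → Fin P.L, ‖((tHol (avgIter P.L U₀ l) (tildIter P.L U₀ U₁ l) ((P.L : ℤ) • zh) (treeWord (boxVec P.L r)) : 𝔸ˣ) : 𝔸) - 1‖
            ≤ ((P.L : ℝ) ^ P.d)⁻¹ * ∑ _r : Fin P.d → Fin P.L, CR * Real.sqrt (B z) :=
              mul_le_mul_of_nonneg_left (Finset.sum_le_sum fun r _ => hR z r) (by positivity)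
          _ = CR * Real.sqrt (B z) := by
              rw [Finset.sum_const, Finset.card_univ, nsmul_eq_mul, hcard]
              field_simp
      · refine congrArg _ (Finset.sum_congr rfl fun r _ => ?_)
        rw [hf, hbox r]
    have hquad : 6 * tz ^ 2 ≤ 6 * (ρ + 3 * δ₂) * (CR * Real.sqrt (B z)) + 12 * (ρ + 3 * δ₂) * Real.sqrt V := by
      have h1 : tz ^ 2 ≤ (ρ + 3 * δ₂) * tloc := by
        rw [sq]; exact mul_le_mul (min_le_left _ _) (min_le_right _ _) htz0 ht0
      rw [htloc] at h1
      nlinarith [h1]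
    calc ‖(vcov P.L U₀ U₁ (l + 1) zh : 𝔸) - 1‖
        ≤ (CR * Real.sqrt (B z) + ((P.L : ℝ) ^ P.d)⁻¹ * ∑ r : Fin P.d → Fin P.L, f (fun μ => (((Site.blockSite z r) μ).val : ℤ)))
            + (6 * (ρ + 3 * δ₂) * (CR * Real.sqrt (B z)) + 12 * (ρ + 3 * δ₂) * Real.sqrt V) := hF1.trans (add_le_add hmeanR hquad)
      _ = _ := by ring
  -- square, sum, contract
  have hsq : ∀ z : Site P (l + 1), ‖(vcov P.L U₀ U₁ (l + 1) (fun μ => ((z μ).val : ℤ)) : 𝔸) - 1‖ ^ 2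
      ≤ 3 * ((1 + 6 * (ρ + 3 * δ₂)) ^ 2 * (CR ^ 2 * B z)
          + (((P.L : ℝ) ^ P.d)⁻¹ * ∑ r : Fin P.d → Fin P.L, f (fun μ => (((Site.blockSite z r) μ).val : ℤ))) ^ 2
          + 144 * (ρ + 3 * δ₂) ^ 2 * ∑ r : Fin P.d → Fin P.L, f (fun μ => (((Site.blockSite z r) μ).val : ℤ)) ^ 2) := by
    intro z
    have h := hpt z
    have h0 : 0 ≤ ‖(vcov P.L U₀ U₁ (l + 1) (fun μ => ((z μ).val : ℤ)) : 𝔸) - 1‖ := norm_nonneg _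
    have hs := pow_le_pow_left₀ h0 h 2
    have sq3 : ∀ a b c : ℝ, (a + b + c) ^ 2 ≤ 3 * (a ^ 2 + b ^ 2 + c ^ 2) := fun a b c => by
      nlinarith [sq_nonneg (a - b), sq_nonneg (b - c), sq_nonneg (a - c)]
    refine hs.trans ((sq3 _ _ _).trans (le_of_eq ?_))
    have hB := hB0 z
    have hV0 : 0 ≤ ∑ r : Fin P.d → Fin P.L, f (fun μ => (((Site.blockSite z r) μ).val : ℤ)) ^ 2 := Finset.sum_nonneg fun _ _ => sq_nonneg _
    rw [mul_pow, mul_pow, Real.sq_sqrt hB, mul_pow, mul_pow, Real.sq_sqrt hV0]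
    ring
  calc ∑ z : Site P (l + 1), ‖(vcov P.L U₀ U₁ (l + 1) (fun μ => ((z μ).val : ℤ)) : 𝔸) - 1‖ ^ 2
      ≤ ∑ z : Site P (l + 1), 3 * ((1 + 6 * (ρ + 3 * δ₂)) ^ 2 * (CR ^ 2 * B z)
          + (((P.L : ℝ) ^ P.d)⁻¹ * ∑ r : Fin P.d → Fin P.L, f (fun μ => (((Site.blockSite z r) μ).val : ℤ))) ^ 2
          + 144 * (ρ + 3 * δ₂) ^ 2 * ∑ r : Fin P.d → Fin P.L, f (fun μ => (((Site.blockSite z r) μ).val : ℤ)) ^ 2) := Finset.sum_le_sum fun z _ => hsq z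
    _ = 3 * (1 + 6 * (ρ + 3 * δ₂)) ^ 2 * CR ^ 2 * ∑ z : Site P (l + 1), B z
          + 3 * ∑ z : Site P (l + 1), (((P.L : ℝ) ^ P.d)⁻¹ * ∑ r : Fin P.d → Fin P.L, f (fun μ => (((Site.blockSite z r) μ).val : ℤ))) ^ 2
          + 3 * (144 * (ρ + 3 * δ₂) ^ 2) * ∑ z : Site P (l + 1), ∑ r : Fin P.d → Fin P.L, f (fun μ => (((Site.blockSite z r) μ).val : ℤ)) ^ 2 := by
        rw [Finset.mul_sum, Finset.mul_sum, Finset.mul_sum, ← Finset.sum_add_distrib, ← Finset.sum_add_distrib]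
        refine Finset.sum_congr rfl fun z _ => ?_
        ring
    _ ≤ 3 * (1 + 6 * (ρ + 3 * δ₂)) ^ 2 * CR ^ 2 * ∑ z : Site P (l + 1), B z
          + 3 * (((P.L : ℝ) ^ P.d)⁻¹ * ∑ x : Site P l, f (fun μ => ((x μ).val : ℤ)) ^ 2)
          + 3 * (144 * (ρ + 3 * δ₂) ^ 2) * ∑ x : Site P l, f (fun μ => ((x μ).val : ℤ)) ^ 2 := by
        rw [sum_blockLift_eq hl (fun x => f x ^ 2)]
        refine add_le_add (add_le_add le_rfl (mul_le_mul_of_nonneg_left (sum_sq_blockMeanLift_le hl f) (by norm_num))) le_rfl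
    _ = _ := by rw [hf]; ring

end Step

end Summit.QuantumFields.YangMills.Theorems.Prop7CombAccFrameMassStep

end
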